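import Literature.NumberTheory.EllipticCurves.OchiaiTwoVariableSelmerDual
import Literature.NumberTheory.EllipticCurves.IwasawaAlgebra
import Literature.NumberTheory.GaloisRepresentations.NearlyOrdinaryPresentationProofs
import Literature.AlgebraicGeometry.Resolution.RegularLocalRingsQuotient
import Literature.RingTheory.CompleteLocalRings.CotangentPresentation
import Literature.RingTheory.KrullDimension.AffineDimension
import Mathlib.RingTheory.KrullDimension.NonZeroDivisors
import Mathlib.RingTheory.DiscreteValuationRing.TFAE
import HarnessLib

set_option autoImplicit false

-- the summit and its single problem are both named `BirchSwinnertonDyer` (registry layout D-0017)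
set_option linter.dupNamespace false

/-!
# The tangent criterion for (Reg): `dim t_R ≤ 1 ∧ R ↠ B ∧ dim B ≥ 2 ⟹ B ≅ ℤ_p⟦T⟧, R = B, (Reg) ∧ (inj)`
# (helper for crux stmt-BirchSwinnertonDyer-20547 `KatoDivisibilityX9`, line `prime_adapted_tau`, stub 3 — the (Reg) conjunct)

Port (verbatim, re-homed) of the bsd-f3-mu cell's kernel-checked sketch `Sketch75.lean` 171a3ab48032e332
(planner-bsd-f3-mu-desc g75, 2026-08-29: D75, the TANGENT CRITERION for the regularity conjunct (Reg) :=
`Ochiai2006.IsRegular p 𝕀` of stub 3; MEMO-desc §75, `HOME/desc/d75/D75-note.md`).  Pure commutative algebra over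
`Λ = ℤ_p⟦T⟧ = IwasawaAlgebra p`; the deformation-theoretic dictionary (`R` = an ordinary deformation ring with
`dim t_R ≤ 1`, `B` = a local Hida–Hecke algebra, `φ : R ↠ B` the classifying map) is prose only:

* §1 `injective_of_surjective_of_two_le`, `bijective_of_surjective_of_two_le` — LEMMA 75.0 (dimension rigidity): a
  ring surjection `ℤ_p⟦T⟧ ↠ B` onto a ring of Krull dimension `≥ 2` is an isomorphism;
* §2 `bijective_of_tangent_presentation` — THM 75.2: `ι : ℤ_p⟦T⟧ ↠ R`, `φ : R ↠ B`, `dim B ≥ 2` ⟹ `φ ∘ ι`, `ι`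
  and `φ` are bijective; `ringEquivOfTangentPresentation`, `ringEquivRT` (the isomorphisms `ℤ_p⟦T⟧ ≃+* B`,
  `R ≃+* B`), `isRegular_of_tangent_presentation` ((Reg) with `𝒪 = ℤ_p`), `isDomain_of_tangent_presentation`,
  `isRegularLocalRing_of_tangent_presentation`;
* §3 `ringKrullDim_eq_two_of_faithful` (a module-finite faithful `Λ`-algebra has dimension `2`),
  `injective_algebraMap_of_two_le` ((inj) from dimension `≥ 2`), `goodShape_of_tangent_presentation` — THM 75.3:
  the package (Reg) ∧ (inj) ∧ `R ≃ B` ∧ `B` a domain;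
* §4 `isLocalHom_of_residue_surjective`, `nonempty_ringEquiv_powerSeries_of_cotangent` — THM 75.1 (intrinsic form):
  a complete Noetherian local `ℤ_p`-algebra with residue field generated by `ℤ_p`, relative cotangent space
  `𝔪/(𝔪² + p)` spanned by ONE element and `dim ≥ 2` is `≃+* ℤ_p⟦T⟧` (no domain hypothesis, no `ℤ_p`-point; cf.
  THM 74.1 of `…ULedgerCollapseStructure.lean`); `isRegular_of_cotangent`, `isDomain_of_cotangent`,
  `not_cotangent_one_of_not_powerSeries`.

Not proved here (paper, D75-note §2–§4): `t_R ≅ H¹_𝓛`, the Greenberg–Wiles count, the class-field-theoretic evaluation.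
Nothing in the tree consumes this file yet (decider #3 of (Reg), awaiting the cell's data ask D75-H).  No ledger item is
closed here; BSD is proved for no curve.  References: [Matsumura1987] Thm. 8.4, §14; Hida, *Modular Forms and Galois
Cohomology*, Lemma 2.28; Mazur 1989 (deformation rings).
-/

noncomputable section

universe u

namespace Summit.BirchSwinnertonDyer.BirchSwinnertonDyer.Theorems.OneSidedTwistSqueezeX9KatoDivisibilityX9ULedger

open IsLocalRing Literature.NumberTheory.EllipticCurves

variable (p : ℕ) [Fact p.Prime]

/-! ## §1 Dimension rigidity of `Λ = ℤ_p⟦T⟧` -/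

section Rigidity

variable {p} in
/-- **LEMMA 75.0 (dimension rigidity).**  A ring surjection `π : ℤ_p⟦T⟧ ↠ B` onto a ring of Krull dimension
`≥ 2` is injective: a non-zero `f ∈ ker π` would make `B` a quotient of `ℤ_p⟦T⟧/(f)`, of dimension `≤ 1`. -/
theorem injective_of_surjective_of_two_le {B : Type} [CommRing B]
    (π : IwasawaAlgebra p →+* B) (hπ : Function.Surjective π)
    (hB : (2 : WithBot ℕ∞) ≤ ringKrullDim B) : Function.Injective π := by
  classical
  rw [injective_iff_map_eq_zero]
  intro f hf
  by_contra hf0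
  have hle : Ideal.span {f} ≤ RingHom.ker π := by
    rw [Ideal.span_singleton_le_iff_mem, RingHom.mem_ker]; exact hf
  have hne : Ideal.span {f} ≠ (⊤ : Ideal (IwasawaAlgebra p)) := by
    intro ht
    have h1 : (1 : IwasawaAlgebra p) ∈ RingHom.ker π := hle (ht ▸ Submodule.mem_top)
    rw [RingHom.mem_ker, map_one] at h1
    haveI : Subsingleton B := subsingleton_of_zero_eq_one h1.symm
    have hbot : ringKrullDim B = ⊥ := ringKrullDim_eq_bot_of_subsingleton
    rw [hbot] at hB
    exact absurd hB (by decide)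
  haveI := Literature.AlgebraicGeometry.Resolution.isLocalRing_quotient hne
  obtain ⟨n, hn⟩ := Literature.AlgebraicGeometry.Resolution.exists_nat_cast_eq_ringKrullDim
    (R := (IwasawaAlgebra p) ⧸ Ideal.span {f})
  have e : ((IwasawaAlgebra p) ⧸ RingHom.ker π) ≃+* B := RingHom.quotientKerEquivOfSurjective hπ
  have h1 : ringKrullDim B ≤ ringKrullDim ((IwasawaAlgebra p) ⧸ Ideal.span {f}) := by
    rw [← ringKrullDim_eq_of_ringEquiv e]
    exact ringKrullDim_le_of_surjective _ (Ideal.Quotient.factor_surjective hle)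
  have h2 := ringKrullDim_quotient_succ_le_of_nonZeroDivisor (mem_nonZeroDivisors_of_ne_zero hf0)
  have h3 : ringKrullDim (IwasawaAlgebra p) = 2 := IwasawaAlgebra.ringKrullDim_eq_two p
  rw [hn] at h1
  rw [hn, h3] at h2
  have h1' : (2 : WithBot ℕ∞) ≤ (n : WithBot ℕ∞) := hB.trans h1
  have h1'' : 2 ≤ n := by exact_mod_cast h1'
  have h2' : n + 1 ≤ 2 := by exact_mod_cast h2
  omega

variable {p} in
/-- LEMMA 75.0, bijective form. -/
theorem bijective_of_surjective_of_two_le {B : Type} [CommRing B]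
    (π : IwasawaAlgebra p →+* B) (hπ : Function.Surjective π)
    (hB : (2 : WithBot ℕ∞) ≤ ringKrullDim B) : Function.Bijective π :=
  ⟨injective_of_surjective_of_two_le π hπ hB, hπ⟩

end Rigidity

/-! ## §2 THM 75.2: `R = 𝕋` for free, and (Reg) with `𝒪 = ℤ_p` -/

section TangentPresentation

variable {p}
variable {R B : Type} [CommRing R] [CommRing B]

/-- **THEOREM 75.2 («R = 𝕋 for free» from tangent dimension one).**  If `R` is a quotient of `ℤ_p⟦T⟧`
(`ι` surjective — for a complete Noetherian local `ℤ_p`-algebra with residue field `𝔽_p` this is EQUIVALENT to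
`dim_𝔽 𝔪_R/(𝔪_R² + pR) ≤ 1`), `φ : R ↠ B` is surjective and `dim B ≥ 2`, then `φ ∘ ι`, `ι` and `φ` are all
bijective.  [Model: `R = R^{ord}_{ρ̄}`, `B = 𝕋'_𝔪`, `φ` the classifying map of `ρ_{𝕋'}`.] -/
theorem bijective_of_tangent_presentation (ι : IwasawaAlgebra p →+* R) (hι : Function.Surjective ι)
    (φ : R →+* B) (hφ : Function.Surjective φ) (hB : (2 : WithBot ℕ∞) ≤ ringKrullDim B) :
    Function.Bijective (φ.comp ι) ∧ Function.Bijective ι ∧ Function.Bijective φ := by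
  have hc : Function.Bijective (φ.comp ι) :=
    bijective_of_surjective_of_two_le (φ.comp ι) (hφ.comp hι) hB
  have hιinj : Function.Injective ι := fun a b hab => hc.1 (by simp [hab])
  have hφinj : Function.Injective φ := by
    intro r s hrs
    obtain ⟨a, rfl⟩ := hι r
    obtain ⟨b, rfl⟩ := hι s
    have hab : a = b := hc.1 (by simpa using hrs)
    rw [hab]
  exact ⟨hc, ⟨hιinj, hι⟩, ⟨hφinj, hφ⟩⟩

/-- THM 75.2 (a): the ring isomorphism `ℤ_p⟦T⟧ ≃+* B`. -/
def ringEquivOfTangentPresentation (ι : IwasawaAlgebra p →+* R) (hι : Function.Surjective ι)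
    (φ : R →+* B) (hφ : Function.Surjective φ) (hB : (2 : WithBot ℕ∞) ≤ ringKrullDim B) :
    IwasawaAlgebra p ≃+* B :=
  RingEquiv.ofBijective (φ.comp ι) (bijective_of_tangent_presentation ι hι φ hφ hB).1

/-- THM 75.2 (b): the isomorphism `R ≃+* B` («R = 𝕋»). -/
def ringEquivRT (ι : IwasawaAlgebra p →+* R) (hι : Function.Surjective ι)
    (φ : R →+* B) (hφ : Function.Surjective φ) (hB : (2 : WithBot ℕ∞) ≤ ringKrullDim B) : R ≃+* B :=
  RingEquiv.ofBijective φ (bijective_of_tangent_presentation ι hι φ hφ hB).2.2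

/-- THM 75.2 (c): **(Reg) with `𝒪 = ℤ_p`** for `B`. -/
theorem isRegular_of_tangent_presentation (ι : IwasawaAlgebra p →+* R) (hι : Function.Surjective ι)
    (φ : R →+* B) (hφ : Function.Surjective φ) (hB : (2 : WithBot ℕ∞) ≤ ringKrullDim B) :
    Ochiai2006.IsRegular p B :=
  ⟨ℤ_[p], inferInstance, inferInstance, inferInstance, inferInstance, inferInstance, inferInstance,
    ⟨(ringEquivOfTangentPresentation ι hι φ hφ hB).symm⟩⟩

/-- THM 75.2 (d): `B` is a domain. -/
theorem isDomain_of_tangent_presentation (ι : IwasawaAlgebra p →+* R) (hι : Function.Surjective ι)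
    (φ : R →+* B) (hφ : Function.Surjective φ) (hB : (2 : WithBot ℕ∞) ≤ ringKrullDim B) : IsDomain B :=
  MulEquiv.isDomain (IwasawaAlgebra p) (ringEquivOfTangentPresentation ι hι φ hφ hB).symm.toMulEquiv

/-- THM 75.2 (e): `B` is a regular local ring. -/
theorem isRegularLocalRing_of_tangent_presentation (ι : IwasawaAlgebra p →+* R)
    (hι : Function.Surjective ι) (φ : R →+* B) (hφ : Function.Surjective φ)
    (hB : (2 : WithBot ℕ∞) ≤ ringKrullDim B) : IsRegularLocalRing B := by
  haveI : IsRegularLocalRing (IwasawaAlgebra p) := by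
    haveI := Literature.NumberTheory.GaloisRepresentations.NearlyOrdinaryPresentationCA.isRegularLocalRing_mvPowerSeries_dvr
      ℤ_[p] 1
    exact IsRegularLocalRing.of_ringEquiv (MvPowerSeries.renameEquiv ℤ_[p] finOneEquiv.symm).toRingEquiv.symm
  exact IsRegularLocalRing.of_ringEquiv (ringEquivOfTangentPresentation ι hι φ hφ hB)

end TangentPresentation

/-! ## §3 The `Λ`-structure side: dimension from faithfulness, (inj) from dimension; the package -/

section LambdaStructure

variable {p}
variable {B : Type} [CommRing B] [Algebra (IwasawaAlgebra p) B] [Module.Finite (IwasawaAlgebra p) B]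

/-- A module-finite FAITHFUL `Λ`-algebra has Krull dimension `2` (integral extensions preserve dimension; tree
`ringKrullDim_eq_of_isIntegral`).  [Model: Hida's `𝕋^{ord}_𝔪 ⊇ Λ`, finite and torsion-free.] -/
theorem ringKrullDim_eq_two_of_faithful [FaithfulSMul (IwasawaAlgebra p) B] : ringKrullDim B = 2 := by
  haveI : Algebra.IsIntegral (IwasawaAlgebra p) B := Algebra.IsIntegral.of_finite _ _
  rw [← Literature.RingTheory.KrullDimension.ringKrullDim_eq_of_isIntegral
    (R := IwasawaAlgebra p) (S := B) (FaithfulSMul.algebraMap_injective _ _)]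
  exact IwasawaAlgebra.ringKrullDim_eq_two p

/-- **(inj) from dimension**: a module-finite `Λ`-algebra of Krull dimension `≥ 2` has injective structure map
(a non-zero `f` in the kernel would make `B` integral over the at most one-dimensional `Λ/(f)`). -/
theorem injective_algebraMap_of_two_le (hB : (2 : WithBot ℕ∞) ≤ ringKrullDim B) :
    Function.Injective (algebraMap (IwasawaAlgebra p) B) := by
  classical
  rw [injective_iff_map_eq_zero]
  intro f hf
  by_contra hf0
  have hle : Ideal.span {f} ≤ RingHom.ker (algebraMap (IwasawaAlgebra p) B) := by
    rw [Ideal.span_singleton_le_iff_mem, RingHom.mem_ker]; exact hf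
  have hne : Ideal.span {f} ≠ (⊤ : Ideal (IwasawaAlgebra p)) := by
    intro ht
    have h1 : (1 : IwasawaAlgebra p) ∈ RingHom.ker (algebraMap (IwasawaAlgebra p) B) :=
      hle (ht ▸ Submodule.mem_top)
    rw [RingHom.mem_ker, map_one] at h1
    haveI : Subsingleton B := subsingleton_of_zero_eq_one h1.symm
    have hbot : ringKrullDim B = ⊥ := ringKrullDim_eq_bot_of_subsingleton
    rw [hbot] at hB
    exact absurd hB (by decide)
  haveI := Literature.AlgebraicGeometry.Resolution.isLocalRing_quotient hne
  let ψ : (IwasawaAlgebra p) ⧸ Ideal.span {f} →+* B :=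
    Ideal.Quotient.lift (Ideal.span {f}) (algebraMap (IwasawaAlgebra p) B) (fun a ha => hle ha)
  have hψ : ψ.comp (Ideal.Quotient.mk (Ideal.span {f})) = algebraMap (IwasawaAlgebra p) B :=
    RingHom.ext fun a => Ideal.Quotient.lift_mk (Ideal.span {f}) _ (fun a ha => hle ha)
  letI : Algebra ((IwasawaAlgebra p) ⧸ Ideal.span {f}) B := ψ.toAlgebra
  haveI : Algebra.IsIntegral (IwasawaAlgebra p) B := Algebra.IsIntegral.of_finite _ _
  haveI : Algebra.IsIntegral ((IwasawaAlgebra p) ⧸ Ideal.span {f}) B := by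
    refine ⟨fun x => ?_⟩
    obtain ⟨P, hPm, hPx⟩ := Algebra.IsIntegral.isIntegral (R := IwasawaAlgebra p) x
    refine ⟨P.map (Ideal.Quotient.mk (Ideal.span {f})), hPm.map _, ?_⟩
    rw [Polynomial.eval₂_map, RingHom.algebraMap_toAlgebra, hψ]
    exact hPx
  have h1 : ringKrullDim B ≤ ringKrullDim ((IwasawaAlgebra p) ⧸ Ideal.span {f}) :=
    Literature.RingTheory.KrullDimension.ringKrullDim_le_of_isIntegral
  have h2 := ringKrullDim_quotient_succ_le_of_nonZeroDivisor (mem_nonZeroDivisors_of_ne_zero hf0)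
  have h3 : ringKrullDim (IwasawaAlgebra p) = 2 := IwasawaAlgebra.ringKrullDim_eq_two p
  obtain ⟨n, hn⟩ := Literature.AlgebraicGeometry.Resolution.exists_nat_cast_eq_ringKrullDim
    (R := (IwasawaAlgebra p) ⧸ Ideal.span {f})
  rw [hn] at h1
  rw [hn, h3] at h2
  have h1' : (2 : WithBot ℕ∞) ≤ (n : WithBot ℕ∞) := hB.trans h1
  have h1'' : 2 ≤ n := by exact_mod_cast h1'
  have h2' : n + 1 ≤ 2 := by exact_mod_cast h2
  omega

/-- **THEOREM 75.3 (the package for stub 3's shape).**  Let `B` be a module-finite faithful `Λ`-algebra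
(`B = 𝕋'_𝔪`), `φ : R ↠ B` a surjection from a ring `R` that is a quotient of `ℤ_p⟦T⟧` (`R = R^{ord}_{ρ̄}` with
`dim t_R ≤ 1`).  Then: (Reg) `Ochiai2006.IsRegular p B` (with `𝒪 = ℤ_p`), (inj), `φ` is an isomorphism
(`R = 𝕋`) and `B` is a domain (ONE branch through `𝔪`). -/
theorem goodShape_of_tangent_presentation [FaithfulSMul (IwasawaAlgebra p) B]
    {R : Type} [CommRing R] (ι : IwasawaAlgebra p →+* R) (hι : Function.Surjective ι)
    (φ : R →+* B) (hφ : Function.Surjective φ) :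
    Ochiai2006.IsRegular p B ∧ Function.Injective (algebraMap (IwasawaAlgebra p) B) ∧
      Function.Bijective φ ∧ IsDomain B := by
  have hB : (2 : WithBot ℕ∞) ≤ ringKrullDim B := (ringKrullDim_eq_two_of_faithful (p := p) (B := B)).symm.le
  exact ⟨isRegular_of_tangent_presentation ι hι φ hφ hB, FaithfulSMul.algebraMap_injective _ _,
    (bijective_of_tangent_presentation ι hι φ hφ hB).2.2, isDomain_of_tangent_presentation ι hι φ hφ hB⟩

end LambdaStructure

/-! ## §4 THM 75.1: the intrinsic cotangent form -/

section Intrinsic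

variable {p}

/-- Residue field `𝔽_p`: if the residue field of the local `ℤ_p`-algebra `I` is generated by the image of
`ℤ_p`, then `ℤ_p → I` is a local homomorphism (i.e. `p ∈ 𝔪_I`). -/
theorem isLocalHom_of_residue_surjective {I : Type} [CommRing I] [IsLocalRing I] [Algebra ℤ_[p] I]
    (hres : ∀ c : I, ∃ l : ℤ_[p], c - algebraMap ℤ_[p] I l ∈ maximalIdeal I) :
    IsLocalHom (algebraMap ℤ_[p] I) := by
  classical
  let r : ℤ_[p] →+* ResidueField I := (residue I).comp (algebraMap ℤ_[p] I)
  have hr : Function.Surjective r := by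
    intro k
    obtain ⟨c, rfl⟩ := residue_surjective k
    obtain ⟨l, hl⟩ := hres c
    refine ⟨l, ?_⟩
    change residue I (algebraMap ℤ_[p] I l) = residue I c
    exact (Ideal.Quotient.eq.mpr hl).symm
  have hmax : (RingHom.ker r).IsMaximal := RingHom.ker_isMaximal_of_surjective r hr
  have hker : RingHom.ker r = maximalIdeal ℤ_[p] := IsLocalRing.eq_maximalIdeal hmax
  refine ⟨fun a ha => ?_⟩
  by_contra hna
  have hmem : a ∈ RingHom.ker r := by
    rw [hker]; exact (mem_maximalIdeal _).mpr (mem_nonunits_iff.mpr hna)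
  rw [RingHom.mem_ker] at hmem
  change residue I (algebraMap ℤ_[p] I a) = 0 at hmem
  rw [residue_eq_zero_iff] at hmem
  exact (mem_nonunits_iff.mp ((mem_maximalIdeal _).mp hmem)) ha

/-- **THEOREM 75.1 (intrinsic tangent criterion).**  Let `I` be a complete Noetherian local `ℤ_p`-algebra with
residue field generated by `ℤ_p` (`= 𝔽_p`), whose relative cotangent space `𝔪_I/(𝔪_I² + p I)` is spanned by
one element `x` (tangent dimension `≤ 1`), and with `dim I ≥ 2`.  Then `I ≃+* ℤ_p⟦T⟧` (hence `I` is a regular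
two-dimensional domain and (Reg) holds with `𝒪 = ℤ_p`).  No domain hypothesis, no `ℤ_p`-point. -/
theorem nonempty_ringEquiv_powerSeries_of_cotangent {I : Type} [CommRing I] [IsLocalRing I]
    [IsNoetherianRing I] [Algebra ℤ_[p] I] [IsAdicComplete (maximalIdeal I) I]
    (hres : ∀ c : I, ∃ l : ℤ_[p], c - algebraMap ℤ_[p] I l ∈ maximalIdeal I)
    {x : I} (hxm : x ∈ maximalIdeal I)
    (hgen : maximalIdeal I ≤ Ideal.span {x} ⊔ (maximalIdeal ℤ_[p]).map (algebraMap ℤ_[p] I) ⊔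
      maximalIdeal I ^ 2)
    (hdim : (2 : WithBot ℕ∞) ≤ ringKrullDim I) :
    Nonempty (I ≃+* PowerSeries ℤ_[p]) := by
  classical
  haveI := isLocalHom_of_residue_surjective hres
  have hxm' : ∀ _i : Unit, x ∈ maximalIdeal I := fun _ => hxm
  have hgen' : maximalIdeal I ≤ Ideal.span (Set.range fun _ : Unit => x) ⊔
      (maximalIdeal ℤ_[p]).map (algebraMap ℤ_[p] I) ⊔ maximalIdeal I ^ 2 := by
    rw [Set.range_const]; exact hgen
  obtain ⟨Θ, hΘsurj, -⟩ :=
    Literature.RingTheory.CompleteLocalRings.exists_mvPowerSeries_algHom_surjective_of_le_sup_sq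
      (Λ := ℤ_[p]) (C := I) hres (fun _ : Unit => x) hxm' hgen'
  have hbij : Function.Bijective (Θ : MvPowerSeries Unit ℤ_[p] →+* I) :=
    bijective_of_surjective_of_two_le (p := p) (Θ : MvPowerSeries Unit ℤ_[p] →+* I) hΘsurj hdim
  exact ⟨(RingEquiv.ofBijective (Θ : MvPowerSeries Unit ℤ_[p] →+* I) hbij).symm⟩

/-- COROLLARY 75.1 (a): (Reg) with `𝒪 = ℤ_p`. -/
theorem isRegular_of_cotangent {I : Type} [CommRing I] [IsLocalRing I]
    [IsNoetherianRing I] [Algebra ℤ_[p] I] [IsAdicComplete (maximalIdeal I) I]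
    (hres : ∀ c : I, ∃ l : ℤ_[p], c - algebraMap ℤ_[p] I l ∈ maximalIdeal I)
    {x : I} (hxm : x ∈ maximalIdeal I)
    (hgen : maximalIdeal I ≤ Ideal.span {x} ⊔ (maximalIdeal ℤ_[p]).map (algebraMap ℤ_[p] I) ⊔
      maximalIdeal I ^ 2)
    (hdim : (2 : WithBot ℕ∞) ≤ ringKrullDim I) : Ochiai2006.IsRegular p I := by
  obtain ⟨e⟩ := nonempty_ringEquiv_powerSeries_of_cotangent hres hxm hgen hdim
  exact ⟨ℤ_[p], inferInstance, inferInstance, inferInstance, inferInstance, inferInstance, inferInstance, ⟨e⟩⟩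

/-- COROLLARY 75.1 (b): such an `I` is a domain (ONE minimal prime: no crossing at `𝔪`). -/
theorem isDomain_of_cotangent {I : Type} [CommRing I] [IsLocalRing I]
    [IsNoetherianRing I] [Algebra ℤ_[p] I] [IsAdicComplete (maximalIdeal I) I]
    (hres : ∀ c : I, ∃ l : ℤ_[p], c - algebraMap ℤ_[p] I l ∈ maximalIdeal I)
    {x : I} (hxm : x ∈ maximalIdeal I)
    (hgen : maximalIdeal I ≤ Ideal.span {x} ⊔ (maximalIdeal ℤ_[p]).map (algebraMap ℤ_[p] I) ⊔
      maximalIdeal I ^ 2)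
    (hdim : (2 : WithBot ℕ∞) ≤ ringKrullDim I) : IsDomain I := by
  obtain ⟨e⟩ := nonempty_ringEquiv_powerSeries_of_cotangent hres hxm hgen hdim
  exact MulEquiv.isDomain (PowerSeries ℤ_[p]) e.toMulEquiv

/-- COROLLARY 75.1 (c): the converse direction of the dichotomy — if `dim I ≥ 2` and `I` is NOT `≃ ℤ_p⟦T⟧`
(e.g. `I` has two minimal primes, or a singular branch), then the cotangent space needs `≥ 2` generators:
no single `x` satisfies `hgen`. -/
theorem not_cotangent_one_of_not_powerSeries {I : Type} [CommRing I] [IsLocalRing I]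
    [IsNoetherianRing I] [Algebra ℤ_[p] I] [IsAdicComplete (maximalIdeal I) I]
    (hres : ∀ c : I, ∃ l : ℤ_[p], c - algebraMap ℤ_[p] I l ∈ maximalIdeal I)
    (hdim : (2 : WithBot ℕ∞) ≤ ringKrullDim I) (hnot : IsEmpty (I ≃+* PowerSeries ℤ_[p])) :
    ∀ x ∈ maximalIdeal I, ¬ (maximalIdeal I ≤ Ideal.span {x} ⊔
      (maximalIdeal ℤ_[p]).map (algebraMap ℤ_[p] I) ⊔ maximalIdeal I ^ 2) := by
  intro x hxm hgen
  obtain ⟨e⟩ := nonempty_ringEquiv_powerSeries_of_cotangent hres hxm hgen hdim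
  exact hnot.false e

end Intrinsic

end Summit.BirchSwinnertonDyer.BirchSwinnertonDyer.Theorems.OneSidedTwistSqueezeX9KatoDivisibilityX9ULedger
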